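import Summits.BirchSwinnertonDyer.BirchSwinnertonDyer.Theorems.ThetaPartnerAtTwoSignedKatoUpToAtTwoOffTwoZetaSpan
import Literature.NumberTheory.EllipticCurves.KatoRankBoundAllPrimesSkeletonProofs
import Literature.NumberTheory.EllipticCurves.KatoDivisibilityColemanKernelSkeletonProofs
import HarnessLib

/-!
# Route `ThetaPartnerAtTwo` (TP2), crux K3 `SignedKatoDivisibilityUpToAtTwo` (item stmt-BirchSwinnertonDyer-20308),
# line `colemanrat` v3: **the `2`-ROBUST road** — the four-term inequality and K3 BY NAME modulo print when EVERY
# equality of the `2`-adic Coleman–Poitou–Tate package holds only UP TO `2^m`-TORSION (the natural output of the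
# `Δ = {±1}` descent `ℚ(μ_{2^∞}) → ℚ_∞` and of a Coleman map at `2` with `2`-power defects), on an ABSTRACT local
# module `P` mapped to `Λ` (width seat `bsd-wall-tp2-p2x-w3`; §1 route-independent, any commutative ring)

HONEST FRAMING (cell `bsd-wall`): THEOREMS ONLY — no definition, no named fact, no instance, no `sorry`; the
K3-level theorems are CONDITIONAL on the displayed hypotheses (Kato Thm. 13.4 (2) at `p = 2` and Gross–Zagier–
Kolyvagin by name; one research package at `p = 2`); closes no item (`proof.conditional`); BSD is NOT proved by
any of this.

## Why this file (what it adds to `…OffTwoRoad` / `…OffTwoOfPub` / `…OffTwoZetaSpan`)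

The lead's weakest package asks for maps that are EXACTLY a complex / EXACTLY a cover, on a submodule `P ≤ Λ`
(the Coleman image) — and records in prose that «exactness AS MAPS may be relaxed to "up to modules killed by a
power of `2`" by whoever proves it: only lengths at `𝔭 ∌ 2` are consumed». This file does that relaxation IN THE
KERNEL, because it is exactly the shape in which `p = 2` objects arrive:
* the `+`/♭ Coleman map at `2` is built over `k_n = ℚ₂(ζ_{2^{n+2}})` (Sprung 2012 p. 1487, `N = n + 2` at `p = 2`)
  and descended along `Δ = Gal(ℚ(μ_{2^∞})/ℚ_∞) = {±1}`, whose cohomology is `2`-torsion: restriction /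
  corestriction compose to `2` and `1 + c`, so kernels and cokernels of the comparison maps
  `Sel(ℚ_n) → Sel(K_n)^Δ`, `(M^Δ → M_Δ)` are killed by `2` (Kato-134-two-Delta reading flag of
  `Kato2004/EulerSystemBoundFineSelmerTwo.lean`);
* «`ker Col⁺ = H¹_+` exactly» (Kobayashi Prop. 8.18 ff., odd `p`) may hold at `2` only up to a finite `2`-group, so
  the local quotient `P = (E⁺(k_∞) ⊗ ℚ₂/ℤ₂)^∨` need not EMBED in `Λ`: here `P` is an abstract `Λ`-module with a map
  `ι : P → Λ` whose kernel is killed by `2^m`;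
* global reciprocity and the cover `ker(X⁺ → X₀) ⊆ im(P)` after the descent hold up to `2^m`.
At a height-one prime `𝔭 ∌ 2`, `2^m` is a unit of `Λ_𝔭` and all these defects vanish after localisation; §1 is
the bookkeeping (four steps, each with the tree's «killed by `c ∉ 𝔭`» lemmas), §2 the K3-level statement.

## What is proved

* §1 `fourTerm_lengthAt_le_upTo` (any commutative ring `R`, modules `H, P, X, Y`, maps `c : H → P`, `ι : P → R`,
  `j : P → X`, `k : X → Y`, an element `u ∉ 𝔭`): if `ker ι`, `ker c` are killed by `u`, `u · j(c x) = 0` for all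
  `x` and `u · ker k ⊆ range j`, then `ℓ_𝔭(X) + ℓ_𝔭(H/Rz) ≤ ℓ_𝔭(Y) + ℓ_𝔭(R/(ι(c z)))` for every `z ∈ H`.
* §2 `signedKatoDivisibilityUpToAtTwo_of_robustPackageTwo_of_pub`: K3 by name from `h134`, `h17` and, per habitat
  datum, dual datum `D` (torsion) and height-one `𝔭 ∌ 2`, a `2`-ROBUST package: pinned `I`, `Y`, an abstract
  `Λ`-module `P` with `ι : P → Λ` (kernel killed by `2^m`), `col : 𝐇¹ → P`, `j : P → X⁺`, `k : X⁺ → X₀` with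
  reciprocity and cover up to `2^m`, and a genuine `2`-adic Euler-system class `s` with `ℓ_𝔭(Λ/(ι col s)) ≤
  ℓ_𝔭(Λ/(L♭))`. Injectivity of `col` (from GZK), `s ≠ 0`, finiteness of `ℓ_𝔭(𝐇¹/Λs)` are derived, not assumed.
* §3 `signedKatoDivisibilityUpToAtTwo_of_robustZetaSpanPackageTwo_of_pub`: the same in the PRINT SHAPE of
  `…OffTwoZetaSpan` (one `P, ι, col` per curve; `j, k` per `D`; zeta clause on the span of genuine classes),
  every clause up to `2^m`.

References: [Kobayashi2003] Thm. 6.2–6.3 (p. 11), (7.17)–(7.21), Thm. 7.3 (pp. 12–13), §8 (pp. 14–22); [Sprung2012]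
p. 1487, Def. 6.1 (p. 1495), §7 (p. 1499); [Kato2004Asterisque] §12.1 (p. 219), Thm. 13.4 (2) (p. 226), §17.13
(p. 279); [Darmon2004] Thm. 3.22; [Washington1997] §13.1; [Bourbaki1989CommAlg] Ch. II §2.4.
-/

set_option autoImplicit false
-- the Theorems namespace of this sub repeats the summit name by design (D-0017 nested layout)
set_option linter.dupNamespace false

noncomputable section

open scoped Classical MatrixGroups ModularForm NumberField

open CongruenceSubgroup WeierstrassCurve Field IsDedekindDomain
  Literature.NumberTheory.GaloisRepresentations
  Literature.NumberTheory.EllipticCurves Literature.NumberTheory.EllipticCurves.ModularForms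
  Literature.NumberTheory.EllipticCurves.Module Literature.NumberTheory.EllipticCurves.Rank1Residual
  Literature.NumberTheory.EllipticCurves.Kobayashi2003 Literature.NumberTheory.EllipticCurves.Kato2004
  Literature.NumberTheory.EllipticCurves.Kato2004.EulerSystemValues ZpExtension
  Summit.BirchSwinnertonDyer.Rank1Residual.Supersingular
  Summit.BirchSwinnertonDyer.BirchSwinnertonDyer.Theses.ThetaPartnerAtTwo

namespace Summit.BirchSwinnertonDyer.BirchSwinnertonDyer.Theorems

namespace SignedKatoOffTwo

/-! ## §1 The four-term inequality when everything holds only up to `u`-torsion, `u ∉ 𝔭` -/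

section Robust

variable {R : Type*} [CommRing R] {H P X Y : Type*} [AddCommGroup H] [_root_.Module R H]
  [AddCommGroup P] [_root_.Module R P] [AddCommGroup X] [_root_.Module R X]
  [AddCommGroup Y] [_root_.Module R Y]

/-- **The four-term inequality up to `u`-torsion.** Let `R` be a commutative ring, `𝔭` a prime, `u ∉ 𝔭`, and
`H →ᶜ P →ʲ X →ᵏ Y`, `ι : P → R` linear maps such that: `ker ι` and `ker c` are killed by `u`; `u · j (c x) = 0`
for all `x` (RECIPROCITY up to `u`); `u · x ∈ range j` whenever `k x = 0` (COVER up to `u`). Then for every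
`z ∈ H`: `ℓ_𝔭(X) + ℓ_𝔭(H/Rz) ≤ ℓ_𝔭(Y) + ℓ_𝔭(R/(ι(c z)))`. Four steps, each invisible-defect bookkeeping at `𝔭`
(`u` is a unit of `R_𝔭`): (A) `ℓ(X) ≤ ℓ(range j) + ℓ(Y)`; (B) `ℓ(range j) = ℓ(P/ker j) ≤ ℓ(P/range c)` as
`u · range c ⊆ ker j`; (C) `ℓ(P/range c) + ℓ(H/Rz) ≤ ℓ(P/c(Rz))` as `H/Rz → P/c(Rz)` has kernel killed by `u`;
(D) `ℓ(P/c(Rz)) ≤ ℓ(R/(ι c z))` as `P/c(Rz) → R/(ι c z)` has kernel killed by `u`. With `u = 1`, `ι` injective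
this is `fourTerm_lengthAt_le_of_comp_eq_zero`. [cite: Kato2004Asterisque, §17.13 (p. 280)]
[cite: Kobayashi2003, (7.17)–(7.21) and proof of Thm. 7.4 (pp. 12–13)] [cite: Bourbaki1989CommAlg, Ch. II §2.4] -/
theorem fourTerm_lengthAt_le_upTo (ι : P →ₗ[R] R) (c : H →ₗ[R] P) (j : P →ₗ[R] X) (k : X →ₗ[R] Y)
    {u : R} (𝔭 : PrimeSpectrum R) (hu : u ∉ 𝔭.asIdeal)
    (hι : ∀ y, ι y = 0 → u • y = 0) (hc : ∀ x, c x = 0 → u • x = 0)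
    (hcj : ∀ x, u • j (c x) = 0) (hjk : ∀ x, k x = 0 → u • x ∈ LinearMap.range j) (z : H) :
    lengthAt R X 𝔭 + lengthAt R (H ⧸ Submodule.span R {z}) 𝔭 ≤
      lengthAt R Y 𝔭 + lengthAt R (R ⧸ Ideal.span {ι (c z)}) 𝔭 := by
  set N : Submodule R H := Submodule.span R {z} with hN
  -- (A) cover up to `u`
  have hA : lengthAt R X 𝔭 ≤ lengthAt R (LinearMap.range j) 𝔭 + lengthAt R Y 𝔭 :=
    lengthAt_le_add_of_smul_ker_le k (LinearMap.range j) 𝔭 hu hjk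
  -- (B) reciprocity up to `u`
  have hB : lengthAt R (LinearMap.range j) 𝔭 ≤ lengthAt R (P ⧸ LinearMap.range c) 𝔭 := by
    rw [← lengthAt_eq_of_linearEquiv j.quotKerEquivRange 𝔭]
    refine lengthAt_quotient_le_of_smul_mem 𝔭 hu ?_
    rintro _ ⟨x, rfl⟩
    rw [LinearMap.mem_ker, map_smul]
    exact hcj x
  -- (C) kernel of `c` up to `u`
  have hC : lengthAt R (P ⧸ LinearMap.range c) 𝔭 + lengthAt R (H ⧸ N) 𝔭 ≤
      lengthAt R (P ⧸ Submodule.map c N) 𝔭 := by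
    have hle : Submodule.map c N ≤ LinearMap.range c := LinearMap.map_le_range
    set M' : Submodule R (P ⧸ Submodule.map c N) :=
      Submodule.map (Submodule.map c N).mkQ (LinearMap.range c) with hM'
    have h1 : lengthAt R (P ⧸ Submodule.map c N) 𝔭 =
        lengthAt R M' 𝔭 + lengthAt R ((P ⧸ Submodule.map c N) ⧸ M') 𝔭 :=
      lengthAt_eq_add_quotient M' 𝔭
    have h2 : lengthAt R ((P ⧸ Submodule.map c N) ⧸ M') 𝔭 = lengthAt R (P ⧸ LinearMap.range c) 𝔭 :=
      lengthAt_eq_of_linearEquiv (Submodule.quotientQuotientEquivQuotient _ _ hle) 𝔭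
    -- `H/N → M'` induced by `c`: well defined, kernel killed by `u`
    have hψN : N ≤ LinearMap.ker ((Submodule.map c N).mkQ ∘ₗ c) := fun x hx ↦ by
      rw [LinearMap.mem_ker, LinearMap.comp_apply, Submodule.mkQ_apply, Submodule.Quotient.mk_eq_zero]
      exact Submodule.mem_map_of_mem hx
    let ψ : (H ⧸ N) →ₗ[R] P ⧸ Submodule.map c N := N.liftQ ((Submodule.map c N).mkQ ∘ₗ c) hψN
    have hψM' : ∀ q, ψ q ∈ M' := by
      intro q
      induction q using Submodule.Quotient.induction_on with
      | H x => exact Submodule.mem_map_of_mem (LinearMap.mem_range_self c x)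
    have h3 : lengthAt R (H ⧸ N) 𝔭 ≤ lengthAt R M' 𝔭 := by
      refine lengthAt_le_of_smul_ker_eq_zero (LinearMap.codRestrict M' ψ hψM') 𝔭 hu fun q hq ↦ ?_
      have hq' : ψ q = 0 := congrArg Subtype.val hq
      induction q using Submodule.Quotient.induction_on with
      | H x =>
        have hx : c x ∈ Submodule.map c N := by
          rw [Submodule.liftQ_apply, LinearMap.comp_apply, Submodule.mkQ_apply,
            Submodule.Quotient.mk_eq_zero] at hq'
          exact hq'
        obtain ⟨n, hn, hcn⟩ := hx
        have hk : c (x - n) = 0 := by rw [map_sub, hcn, sub_self]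
        have h0 : u • x = u • n := by
          have h := hc _ hk
          rw [smul_sub] at h
          exact sub_eq_zero.mp h
        rw [← Submodule.Quotient.mk_smul, Submodule.Quotient.mk_eq_zero, h0]
        exact N.smul_mem u hn
    calc lengthAt R (P ⧸ LinearMap.range c) 𝔭 + lengthAt R (H ⧸ N) 𝔭
        ≤ lengthAt R (P ⧸ LinearMap.range c) 𝔭 + lengthAt R M' 𝔭 := add_le_add le_rfl h3
      _ = lengthAt R (P ⧸ Submodule.map c N) 𝔭 := by rw [h1, h2, add_comm]
  -- (D) kernel of `ι` up to `u`
  have hD : lengthAt R (P ⧸ Submodule.map c N) 𝔭 ≤ lengthAt R (R ⧸ Ideal.span {ι (c z)}) 𝔭 := by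
    have hφN : Submodule.map c N ≤ LinearMap.ker ((Ideal.span {ι (c z)}).mkQ ∘ₗ ι) := by
      rw [LinearMap.ker_comp, Submodule.ker_mkQ, hN, Submodule.map_span, Set.image_singleton,
        Submodule.span_singleton_le_iff_mem, Submodule.mem_comap]
      exact Ideal.subset_span rfl
    let φ : (P ⧸ Submodule.map c N) →ₗ[R] R ⧸ Ideal.span {ι (c z)} :=
      (Submodule.map c N).liftQ ((Ideal.span {ι (c z)}).mkQ ∘ₗ ι) hφN
    refine lengthAt_le_of_smul_ker_eq_zero φ 𝔭 hu fun q hq ↦ ?_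
    induction q using Submodule.Quotient.induction_on with
    | H y =>
      have hy : ι y ∈ Ideal.span {ι (c z)} := by
        rw [Submodule.liftQ_apply, LinearMap.comp_apply, Submodule.mkQ_apply,
          Submodule.Quotient.mk_eq_zero] at hq
        exact hq
      obtain ⟨r, hr⟩ := Ideal.mem_span_singleton'.mp hy
      have h0 : ι (y - r • c z) = 0 := by rw [map_sub, map_smul, smul_eq_mul, hr, sub_self]
      have h1 : u • y = (u * r) • c z := by
        have h := hι _ h0
        rw [smul_sub] at h
        rw [mul_smul]
        exact sub_eq_zero.mp h
      rw [← Submodule.Quotient.mk_smul, Submodule.Quotient.mk_eq_zero, h1, ← map_smul]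
      exact Submodule.mem_map_of_mem (N.smul_mem _ (Submodule.mem_span_singleton_self z))
  calc lengthAt R X 𝔭 + lengthAt R (H ⧸ N) 𝔭
      ≤ (lengthAt R (P ⧸ LinearMap.range c) 𝔭 + lengthAt R Y 𝔭) + lengthAt R (H ⧸ N) 𝔭 :=
        add_le_add (hA.trans (add_le_add hB le_rfl)) le_rfl
    _ = lengthAt R Y 𝔭 + (lengthAt R (P ⧸ LinearMap.range c) 𝔭 + lengthAt R (H ⧸ N) 𝔭) := by ring
    _ ≤ lengthAt R Y 𝔭 + lengthAt R (R ⧸ Ideal.span {ι (c z)}) 𝔭 := add_le_add le_rfl (hC.trans hD)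

/-- A power of an element outside a prime ideal is outside it. [folklore] -/
theorem pow_not_mem_of_not_mem {u : R} (𝔭 : PrimeSpectrum R) (hu : u ∉ 𝔭.asIdeal) (m : ℕ) :
    u ^ m ∉ 𝔭.asIdeal :=
  fun h ↦ hu (𝔭.isPrime.mem_of_pow_mem m h)

end Robust

/-! ## §2 K3 BY NAME, modulo print, from the `2`-ROBUST package -/

section AtTwo

/-- **Injectivity of a Coleman map into an ABSTRACT local module, from Gross–Zagier–Kolyvagin.** In analytic rank
`0`, for `Λ`-linear `col : 𝐇¹_Γ(T_pW) → P` and `ι : P → Λ` with `ι (col s) ≠ 0` for some `s`, `col` is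
injective (`rank_Λ 𝐇¹ ≤ 1`, torsion free, `Λ` a domain; Kato (17.13.2)); variant of `injective_col_of_gzk` with
`P` no longer a submodule of `Λ`. [cite: Kato2004Asterisque, §17.13 (17.13.2) (p. 279)] [cite: Darmon2004, Thm. 3.22] -/
theorem injective_col_of_gzk' (h17 : rank_eq_analyticRank_of_analyticRank_le_one)
    {W : WeierstrassCurve ℚ} [W.IsElliptic] (hr : W.analyticRank = 0) {p : ℕ} [Fact p.Prime]
    [ContinuousSMul ℤ_[p] (W.tateModule p)] {κ : ZpExtension ℚ p} {γ : Field.absoluteGaloisGroup ℚ}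
    (hκ : κ.IsCyclotomic) (hγ : κ.IsTopGenerator γ) (I : Kato2004.IwasawaH1Data W p κ γ)
    {P : Type*} [AddCommGroup P] [_root_.Module (IwasawaAlgebra p) P]
    (ι : P →ₗ[IwasawaAlgebra p] IwasawaAlgebra p) (col : I.H →ₗ[IwasawaAlgebra p] P) {s : I.H}
    (hcs : ι (col s) ≠ 0) : Function.Injective col := by
  let col' : I.H →ₗ[IwasawaAlgebra p] (⊤ : Submodule (IwasawaAlgebra p) (IwasawaAlgebra p)) :=
    LinearMap.codRestrict ⊤ (ι ∘ₗ col) fun _ ↦ trivial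
  have hcs' : ((⊤ : Submodule (IwasawaAlgebra p) (IwasawaAlgebra p)).subtype (col' s) : IwasawaAlgebra p) ≠ 0 :=
    hcs
  have hinj' := injective_col_of_gzk h17 hr hκ hγ I col' hcs'
  intro x y hxy
  exact hinj' (Subtype.ext (by change ι (col x) = ι (col y); rw [hxy]))

/-- **K3 `SignedKatoDivisibilityUpToAtTwo` BY NAME, MODULO PRINT, from the `2`-ROBUST package.** Granted Kato
Thm. 13.4 (2) at `p = 2` (`h134`) and Gross–Zagier–Kolyvagin (`h17`), K3 follows if for every habitat datum, dual
datum `D` of `Sel⁺(E/ℚ_∞)` (torsion) and height-one `𝔭 ∌ 2` there are: pinned `I` (`𝐇¹_Γ(T₂E)`), `Y` (`X₀`), an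
ABSTRACT `Λ`-module `P` (the descended local quotient `(E⁺(k_∞) ⊗ ℚ₂/ℤ₂)^∨`, not assumed inside `Λ`), `Λ`-linear
`ι : P → Λ` (the `+`/♭ Coleman map; kernel killed by `2^m` — «`ker Col⁺ = H¹_+`» only up to a finite `2`-group),
`col : 𝐇¹ → P` (localisation), `j : P → X⁺`, `k : X⁺ → X₀` with RECIPROCITY `2^m · j(col x) = 0` and COVER
`2^m · ker k ⊆ range j` (Poitou–Tate along `ℚ(μ_{2^∞})` then `Δ = {±1}`-descent: all defects `2`-torsion), an
exponent `m`, and a genuine `2`-adic Euler-system class `s` with `ℓ_𝔭(Λ/(ι col s)) ≤ ℓ_𝔭(Λ/(L♭))`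
(«`Col⁺(z_Kato) ∼ L♭`» at `𝔭`). Derived, not assumed: `ι col s ≠ 0`, `s ≠ 0`, injectivity of `col`
(`injective_col_of_gzk'`), `ℓ_𝔭(𝐇¹/Λs) < ⊤` (`lengthAt_quotient_span_ne_top_of_gzk`); then §1 with `u = C(2)^m ∉ 𝔭`
gives stub (C2), (K2) is `h134` by name, and the length road + `…_of_offTwo` give K3.
[cite: Kobayashi2003, Thm. 6.2–6.3 (p. 11), (7.17)–(7.21), Thm. 7.3 (pp. 12–13)] [cite: Kato2004Asterisque, §12.1 (p. 219), Thm. 13.4 (2) (p. 226), §17.13 (p. 279)]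
[cite: Sprung2012, p. 1487 and Def. 6.1 (p. 1495)] [cite: Washington1997, §13.1] [cite: Darmon2004, Thm. 3.22] -/
theorem signedKatoDivisibilityUpToAtTwo_of_robustPackageTwo_of_pub
    (h134 : Kato2004.thm13_4_two_lengthAt_fineSelmerDual_le_of_isEulerSystemClassTwo)
    (h17 : rank_eq_analyticRank_of_analyticRank_le_one)
    (hR : ∀ (W : WeierstrassCurve ℚ) [W.IsElliptic] [W.IsGloballyMinimal],
      ¬ W.HasCM → W.analyticRank = 0 → GoodSS W 2 → W.frobeniusTrace 2 = 0 →
      ∀ (κ : ZpExtension ℚ 2) (γ : Field.absoluteGaloisGroup ℚ) (hκ : κ.IsCyclotomic),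
        κ.IsTopGenerator γ → IsCyclotomicVariable 2 γ →
        ∀ [NeZero (W.conductorNorm ℤ)] (f : CuspForm (Gamma0 (W.conductorNorm ℤ)) 2),
          IsNewformOf W f → ∀ (ϖ : ℚ), (ϖ : ℝ) * W.realPeriodRat = plusPeriod f →
        ∀ (Lplus Lminus : IwasawaAlgebra 2), IsPollackPair f 2 Lplus Lminus →
        ∀ (D : SignedSelmerDualData W κ γ 1) [ContinuousSMul ℤ_[2] (W.tateModule 2)]
          [Module.Free ℤ_[2] (W.tateModule 2)] [Module.Finite ℤ_[2] (W.tateModule 2)],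
          Module.IsTorsion (IwasawaAlgebra 2) D.X →
          ∀ 𝔭 : PrimeSpectrum (IwasawaAlgebra 2), 𝔭.asIdeal.height = 1 →
            PowerSeries.C (2 : ℤ_[2]) ∉ 𝔭.asIdeal →
          ∃ (I : Kato2004.IwasawaH1Data W 2 κ γ) (Y : W.FineSelmerDualData κ γ)
            (P : Type) (_ : AddCommGroup P) (_ : _root_.Module (IwasawaAlgebra 2) P)
            (ι : P →ₗ[IwasawaAlgebra 2] IwasawaAlgebra 2) (col : I.H →ₗ[IwasawaAlgebra 2] P)
            (j : P →ₗ[IwasawaAlgebra 2] D.X) (k : D.X →ₗ[IwasawaAlgebra 2] Y.X) (s : I.H) (m : ℕ),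
            (∀ y, ι y = 0 → (PowerSeries.C (2 : ℤ_[2]) : IwasawaAlgebra 2) ^ m • y = 0) ∧
            (∀ x, (PowerSeries.C (2 : ℤ_[2]) : IwasawaAlgebra 2) ^ m • j (col x) = 0) ∧
            (∀ x, k x = 0 → (PowerSeries.C (2 : ℤ_[2]) : IwasawaAlgebra 2) ^ m • x ∈ LinearMap.range j) ∧
            Kato2004.IsEulerSystemClassTwo W hκ I s ∧
            lengthAt (IwasawaAlgebra 2) (IwasawaAlgebra 2 ⧸ Ideal.span {ι (col s)}) 𝔭 ≤
              lengthAt (IwasawaAlgebra 2) (IwasawaAlgebra 2 ⧸ Ideal.span {kobayashiL 1 Lplus Lminus}) 𝔭) :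
    SignedKatoDivisibilityUpToAtTwo := by
  refine signedKatoDivisibilityUpToAtTwo_of_offTwo
    (offTwo_of_colemanLengthTwo_of_katoBoundTwo
      (fun W _ _ hcm hr hss ha κ γ hκ hγ hcv _ f hf ϖ hϖ Lplus Lminus hPP D _ _ _ hX 𝔭 h𝔭 hp𝔭 ↦ ?_)
      (stub_katoBoundTwo_of_thm13_4_two h134))
  obtain ⟨I, Y, P, _, _, ι, col, j, k, s, m, hι, hcj, hjk, hES, hdiv⟩ :=
    hR W hcm hr hss ha κ γ hκ hγ hcv f hf ϖ hϖ Lplus Lminus hPP D hX 𝔭 h𝔭 hp𝔭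
  have hL : kobayashiL 1 Lplus Lminus ≠ 0 := by rw [kobayashiL, if_pos rfl]; exact hPP.2.1
  have hcs : ι (col s) ≠ 0 := ne_zero_of_lengthAt_quotient_span_le hL 𝔭 h𝔭 hdiv
  have hs0 : s ≠ 0 := by
    rintro rfl
    exact hcs (by rw [map_zero, map_zero])
  have hinj := injective_col_of_gzk' h17 hr hκ hγ I ι col hcs
  have hu : (PowerSeries.C (2 : ℤ_[2]) : IwasawaAlgebra 2) ^ m ∉ 𝔭.asIdeal := pow_not_mem_of_not_mem 𝔭 hp𝔭 m
  have h4 := fourTerm_lengthAt_le_upTo ι col j k 𝔭 hu hι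
    (fun x hx ↦ by rw [hinj (hx.trans (map_zero col).symm), smul_zero]) hcj hjk s
  exact ⟨I, Y, s, (Kato2004.isEulerSystemClassTwo_iff W hκ I s).mp hES, hs0,
    lengthAt_quotient_span_ne_top_of_gzk h17 hr hκ hγ I hs0 𝔭 (le_of_eq h𝔭),
    h4.trans (add_le_add le_rfl hdiv)⟩

/-- **K3 BY NAME, MODULO PRINT, from the `2`-ROBUST package IN THE SHAPE OF THE PRINT** (capstone of the width
seat's two roads): per habitat datum ONE abstract local module `P` with `ι : P → Λ` (the `+`/♭ Coleman map at `2`,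
kernel killed by `2^m`) and ONE `col : 𝐇¹_Γ(T₂E) → P`; per dual datum `D` (torsion) the Poitou–Tate maps `j, k`
with reciprocity and cover UP TO `2^m`; and at every height-one `𝔭 ∌ 2` the zeta clause ON THE SPAN of the genuine
`2`-adic Euler-system classes, `∃ z ∈ span{genuine}, ℓ_𝔭(Λ/(ι col z)) ≤ ℓ_𝔭(Λ/(L♭))` («`L♭ ∈ Col⁺(Z)_𝔭`»).
The ultrametric inequality (`exists_lengthAt_quotient_span_apply_le_of_mem_span`, file `…OffTwoZetaSpan`) picks
ONE genuine class, and `signedKatoDivisibilityUpToAtTwo_of_robustPackageTwo_of_pub` concludes. This is the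
statement a typer can transcribe clause by clause from Kobayashi Thm. 6.2/6.3/7.3 ∕ Sprung 2012 §7 READ AT
`p = 2` with every `Δ = {±1}`-descent defect allowed. [cite: Kobayashi2003, Thm. 6.2–6.3 (p. 11), (7.17)–(7.21), Thm. 7.3 (pp. 12–13)]
[cite: Kato2004Asterisque, Thm. 12.5–12.6 (p. 222), Thm. 13.4 (2) (p. 226), §17.13 (p. 279)] [cite: Sprung2012, Def. 6.1 (p. 1495), §7 (p. 1499)]
[cite: Darmon2004, Thm. 3.22] -/
theorem signedKatoDivisibilityUpToAtTwo_of_robustZetaSpanPackageTwo_of_pub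
    (h134 : Kato2004.thm13_4_two_lengthAt_fineSelmerDual_le_of_isEulerSystemClassTwo)
    (h17 : rank_eq_analyticRank_of_analyticRank_le_one)
    (hCK : ∀ (W : WeierstrassCurve ℚ) [W.IsElliptic] [W.IsGloballyMinimal],
      ¬ W.HasCM → W.analyticRank = 0 → GoodSS W 2 → W.frobeniusTrace 2 = 0 →
      ∀ (κ : ZpExtension ℚ 2) (γ : Field.absoluteGaloisGroup ℚ) (hκ : κ.IsCyclotomic),
        κ.IsTopGenerator γ → IsCyclotomicVariable 2 γ →
        ∀ [NeZero (W.conductorNorm ℤ)] (f : CuspForm (Gamma0 (W.conductorNorm ℤ)) 2),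
          IsNewformOf W f → ∀ (ϖ : ℚ), (ϖ : ℝ) * W.realPeriodRat = plusPeriod f →
        ∀ (Lplus Lminus : IwasawaAlgebra 2), IsPollackPair f 2 Lplus Lminus →
        ∀ [ContinuousSMul ℤ_[2] (W.tateModule 2)] [Module.Free ℤ_[2] (W.tateModule 2)]
          [Module.Finite ℤ_[2] (W.tateModule 2)],
        ∃ (I : Kato2004.IwasawaH1Data W 2 κ γ)
          (P : Type) (_ : AddCommGroup P) (_ : _root_.Module (IwasawaAlgebra 2) P)
          (ι : P →ₗ[IwasawaAlgebra 2] IwasawaAlgebra 2) (col : I.H →ₗ[IwasawaAlgebra 2] P) (m : ℕ),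
          (∀ y, ι y = 0 → (PowerSeries.C (2 : ℤ_[2]) : IwasawaAlgebra 2) ^ m • y = 0) ∧
          (∀ (D : SignedSelmerDualData W κ γ 1), Module.IsTorsion (IwasawaAlgebra 2) D.X →
            ∃ (Y : W.FineSelmerDualData κ γ) (j : P →ₗ[IwasawaAlgebra 2] D.X)
              (k : D.X →ₗ[IwasawaAlgebra 2] Y.X),
              (∀ x, (PowerSeries.C (2 : ℤ_[2]) : IwasawaAlgebra 2) ^ m • j (col x) = 0) ∧
              (∀ x, k x = 0 → (PowerSeries.C (2 : ℤ_[2]) : IwasawaAlgebra 2) ^ m • x ∈ LinearMap.range j)) ∧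
          (∀ 𝔭 : PrimeSpectrum (IwasawaAlgebra 2), 𝔭.asIdeal.height = 1 →
            PowerSeries.C (2 : ℤ_[2]) ∉ 𝔭.asIdeal →
            ∃ z ∈ Submodule.span (IwasawaAlgebra 2) {g : I.H | Kato2004.IsEulerSystemClassTwo W hκ I g},
              lengthAt (IwasawaAlgebra 2) (IwasawaAlgebra 2 ⧸ Ideal.span {ι (col z)}) 𝔭 ≤
                lengthAt (IwasawaAlgebra 2) (IwasawaAlgebra 2 ⧸ Ideal.span {kobayashiL 1 Lplus Lminus}) 𝔭)) :
    SignedKatoDivisibilityUpToAtTwo := by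
  refine signedKatoDivisibilityUpToAtTwo_of_robustPackageTwo_of_pub h134 h17
    fun W _ _ hcm hr hss ha κ γ hκ hγ hcv _ f hf ϖ hϖ Lplus Lminus hPP D _ _ _ hX 𝔭 h𝔭 hp𝔭 ↦ ?_
  obtain ⟨I, P, _, _, ι, col, m, hι, hPT, hZ⟩ := hCK W hcm hr hss ha κ γ hκ hγ hcv f hf ϖ hϖ Lplus Lminus hPP
  obtain ⟨Y, j, k, hcj, hjk⟩ := hPT D hX
  obtain ⟨z, hz, hzle⟩ := hZ 𝔭 h𝔭 hp𝔭
  have hL : kobayashiL 1 Lplus Lminus ≠ 0 := by rw [kobayashiL, if_pos rfl]; exact hPP.2.1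
  have hz0 : ι (col z) ≠ 0 := ne_zero_of_lengthAt_quotient_span_le hL 𝔭 h𝔭 hzle
  obtain ⟨g, hg, hgle⟩ := exists_lengthAt_quotient_span_apply_le_of_mem_span col ι _ hz hz0 𝔭 h𝔭
  exact ⟨I, Y, P, inferInstance, inferInstance, ι, col, j, k, g, m, hι, hcj, hjk, hg, hgle.trans hzle⟩

end AtTwo

end SignedKatoOffTwo

end Summit.BirchSwinnertonDyer.BirchSwinnertonDyer.Theorems

end
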